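import Literature.NumberTheory.LFunctions.NicolasJExplicit
import Literature.NumberTheory.LFunctions.TrivialZerosSimple
import HarnessLib

/-!
# Differencing the explicit formula for `ψ₁`: explicit bounds for `ψ(x) − x` under RH

Topic: `Literature/NumberTheory/LFunctions`. THEOREMS (everything proved). Analytic step of the
discharge of `Literature.NumberTheory.LFunctions.schoenfeld_explicit` (L. Schoenfeld, *Sharper bounds for the
Chebyshev functions θ(x) and ψ(x). II*, Math. Comp. 30 (1976), Thm. 10 and Cor. 1: under RH,
`|ψ(x) − x| < √x log² x/(8π)` for `x ≥ 73.2` and `|π(x) − li(x)| < √x log x/(8π)` for `x ≥ 2657`).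
Schoenfeld obtains Theorem 10 from the explicit formula for `∫ψ` differenced once (Rosser–Schoenfeld
1975, Lemma 8 with `m = 1`), the sum over the zeros being split at a height `T`: below `T` each
zero contributes `≪ √x/|ρ|`, above `T` it contributes `≪ x^{3/2}/(h|ρ|²)`. This file proves that
inequality in the following parametrised form, from the tree's absolutely convergent explicit
formula `ψ₁(t) − t²/2 = −Z(t) − (log 2π)t + E(t)` (`NicolasJExplicit.Rone_eq_explicit`,
`Z(t) = ∑_ρ m(ρ)t^{ρ+1}/(ρ(ρ+1))`), Landau's differencing inequalities
`hψ(x) ≤ ψ₁(x+h) − ψ₁(x)`, `ψ₁(x) − ψ₁(x−h) ≤ hψ(x)` (`NicolasJ.psiOne_sub_psiOne`), the identity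
`∑_ρ m(ρ)/|ρ|² = β` under RH (`hasSum_zeroOrder_div_norm_sq_of_RH`, `β = nicolasBeta`) and the
explicit remainder `0 ≤ Re E(y) − Re E(x) ≤ x/(2(x²−1))` (`re_psiOneRemainder_sub_mem`,
`TrivialZerosSimple.lean`). With

* `zerosUpTo T` — the (finite) set of non-trivial zeros `ρ` with `|Im ρ| ≤ T`,
* `sumInvNorm T = ∑_{|Im ρ| ≤ T} m(ρ)/|ρ|`, `sumInvNormSq T = ∑_{|Im ρ| ≤ T} m(ρ)/|ρ|²`,

the results are, under RH and for every real `T`: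

* `norm_Zsum_sub_le` — `‖Z(y) − Z(x)‖ ≤ (y−x)√y · sumInvNorm T + 2y^{3/2}(β − sumInvNormSq T)`
  (`1 ≤ x ≤ y`): per zero, `|y^{ρ+1} − x^{ρ+1}|/|ρ(ρ+1)| = |∫_x^y t^ρ dt|/|ρ| ≤ (y−x)√y/|ρ|`, or
  `≤ 2y^{3/2}/|ρ|²`;
* `psi_sub_self_le` — **`ψ(x) − x ≤ h/2 − log 2π + √(x+h)·sumInvNorm T
  + (2(x+h)^{3/2}/h)(β − sumInvNormSq T) + x/(2h(x²−1))`** (`x > 1`, `h > 0`);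
* `neg_le_psi_sub_self` — **`ψ(x) − x ≥ −h/2 − log 2π − √x·sumInvNorm T − (2x^{3/2}/h)(β − sumInvNormSq T)`**
  (`h > 0`, `x − h > 1`).

The zero sums `sumInvNorm T`, `sumInvNormSq T` are bounded elsewhere (from the tree's certified
first 2000 zeros below height 2516 and from `N(T) = θ(T)/π + 1 + S(T)` with the explicit `S(T)`
bound `abs_zetaArgS_le` above it). Choosing `h ≍ √x`, `T ≍ √x` recovers Schoenfeld's shape
`|ψ(x) − x| ≤ √x log x (log x − c)/(8π)`.

## References

* L. Schoenfeld, *Sharper bounds for the Chebyshev functions θ(x) and ψ(x). II*, Math. Comp. 30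
  (1976), 337–360, Thm. 10 and its proof (pp. 337–339). [Schoenfeld1976]
* J. B. Rosser, L. Schoenfeld, *Sharper bounds for the Chebyshev functions θ(x) and ψ(x)*, Math.
  Comp. 29 (1975), 243–269, Lemma 8. [RosserSchoenfeld1975]
* H. L. Montgomery, R. C. Vaughan, *Multiplicative Number Theory I*, CUP 2007, §12.1.1 Ex. 6,
  (13.7)–(13.8) and the proof of Thm. 13.1. [MontgomeryVaughan2007]
-/

noncomputable section

open Complex Filter Set MeasureTheory Topology intervalIntegral
open scoped Real Chebyshev

namespace Literature.NumberTheory.LFunctions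

namespace SchoenfeldBound

open NicolasJExplicit NicolasJ

/-! ### The zeros up to height `T` and the two finite zero sums -/

/-- The non-trivial zeros `ρ` with `|Im ρ| ≤ T` (both signs of `Im ρ`). [folklore] -/
def zerosUpToSet (T : ℝ) : Set Zeros := {ρ | |(ρ : ℂ).im| ≤ T}

/-- The zeros with `|Im ρ| ≤ T` form a finite set (they lie in the compact disc `|s| ≤ |T| + 1`,
which meets the discrete zero set of `ζ` in a finite set). [folklore] -/
theorem zerosUpToSet_finite (T : ℝ) : (zerosUpToSet T).Finite := by
  have hK : IsCompact (Metric.closedBall (0 : ℂ) (|T| + 1)) := isCompact_closedBall _ _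
  have hfin := hK.inter_riemannZetaZeros_finite
  have hsub : zerosUpToSet T ⊆ (fun ρ : Zeros ↦ (ρ : ℂ)) ⁻¹'
      (Metric.closedBall (0 : ℂ) (|T| + 1) ∩ riemannZetaZeros) := by
    intro ρ hρ
    have hT : |(ρ : ℂ).im| ≤ T := hρ
    refine ⟨?_, ZetaZeros.riemannZetaNontrivialZeros.zeta_eq_zero ρ.2⟩
    rw [Metric.mem_closedBall, dist_zero_right]
    have h1 := re_pos ρ.2
    have h2 := re_lt_one ρ.2
    have h3 : ‖(ρ : ℂ)‖ ≤ |(ρ : ℂ).re| + |(ρ : ℂ).im| := Complex.norm_le_abs_re_add_abs_im _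
    rw [abs_of_pos h1] at h3
    linarith [le_abs_self T]
  exact (hfin.preimage Subtype.coe_injective.injOn).subset hsub

/-- The finite set of non-trivial zeros `ρ` with `|Im ρ| ≤ T`. [folklore] -/
def zerosUpTo (T : ℝ) : Finset Zeros := (zerosUpToSet_finite T).toFinset

/-- Membership in `zerosUpTo T`. [folklore] -/
theorem mem_zerosUpTo {T : ℝ} {ρ : Zeros} : ρ ∈ zerosUpTo T ↔ |(ρ : ℂ).im| ≤ T := by
  simp [zerosUpTo, zerosUpToSet]

/-- `sumInvNorm T = ∑_{|Im ρ| ≤ T} m(ρ)/|ρ|` (Schoenfeld's `∑_{|γ| ≤ T} 1/|ρ|`, with multiplicity).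
[cite: Schoenfeld1976, proof of Thm. 10] -/
def sumInvNorm (T : ℝ) : ℝ := ∑ ρ ∈ zerosUpTo T, (riemannZetaZeroOrder (ρ : ℂ) : ℝ) / ‖(ρ : ℂ)‖

/-- `sumInvNormSq T = ∑_{|Im ρ| ≤ T} m(ρ)/|ρ|²` (the part of `β = ∑_ρ m(ρ)/|ρ|²` below height `T`).
[cite: Schoenfeld1976, proof of Thm. 10] -/
def sumInvNormSq (T : ℝ) : ℝ := ∑ ρ ∈ zerosUpTo T, (riemannZetaZeroOrder (ρ : ℂ) : ℝ) / ‖(ρ : ℂ)‖ ^ 2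

/-- `sumInvNorm T ≥ 0`. [folklore] -/
theorem sumInvNorm_nonneg (T : ℝ) : 0 ≤ sumInvNorm T :=
  Finset.sum_nonneg fun ρ _ ↦ div_nonneg (zeroOrder_nonneg' ρ) (norm_nonneg _)

/-- `sumInvNormSq T ≥ 0`. [folklore] -/
theorem sumInvNormSq_nonneg (T : ℝ) : 0 ≤ sumInvNormSq T :=
  Finset.sum_nonneg fun ρ _ ↦ div_nonneg (zeroOrder_nonneg' ρ) (sq_nonneg _)

/-- Under RH, `sumInvNormSq T ≤ β` (every partial sum of `∑ m(ρ)/|ρ|² = β`). [cite: Nicolas2012, (1.3)] -/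
theorem sumInvNormSq_le_nicolasBeta (hRH : RiemannHypothesis) (T : ℝ) :
    sumInvNormSq T ≤ nicolasBeta :=
  sum_zeroOrder_div_norm_sq_le_nicolasBeta hRH _

/-- **The tail of `β` above height `T`**: under RH,
`∑_{|Im ρ| > T} m(ρ)/|ρ|² = β − sumInvNormSq T`, as a `HasSum` over all zeros of the function
vanishing on `zerosUpTo T`. [cite: Nicolas2012, (1.3)] -/
theorem hasSum_tail_of_RH (hRH : RiemannHypothesis) (T : ℝ) :
    HasSum (fun ρ : Zeros ↦ if ρ ∈ zerosUpTo T then 0 else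
      (riemannZetaZeroOrder (ρ : ℂ) : ℝ) / ‖(ρ : ℂ)‖ ^ 2) (nicolasBeta - sumInvNormSq T) := by
  have hall := hasSum_zeroOrder_div_norm_sq_of_RH hRH
  have hfin : HasSum (fun ρ : Zeros ↦ if ρ ∈ zerosUpTo T then
      (riemannZetaZeroOrder (ρ : ℂ) : ℝ) / ‖(ρ : ℂ)‖ ^ 2 else 0) (sumInvNormSq T) := by
    have h : HasSum (fun ρ : Zeros ↦ if ρ ∈ zerosUpTo T then
        (riemannZetaZeroOrder (ρ : ℂ) : ℝ) / ‖(ρ : ℂ)‖ ^ 2 else 0)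
        (∑ ρ ∈ zerosUpTo T, (if ρ ∈ zerosUpTo T then
          (riemannZetaZeroOrder (ρ : ℂ) : ℝ) / ‖(ρ : ℂ)‖ ^ 2 else 0)) :=
      hasSum_sum_of_ne_finset_zero (fun ρ hρ ↦ if_neg hρ)
    have hs : ∑ ρ ∈ zerosUpTo T, (if ρ ∈ zerosUpTo T then
        (riemannZetaZeroOrder (ρ : ℂ) : ℝ) / ‖(ρ : ℂ)‖ ^ 2 else 0) = sumInvNormSq T :=
      Finset.sum_congr rfl fun ρ hρ ↦ if_pos hρ
    rwa [hs] at h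
  have hsub := hall.sub hfin
  refine hsub.congr_fun fun ρ ↦ ?_
  by_cases hρ : ρ ∈ zerosUpTo T <;> simp [hρ]

/-! ### Under RH: `|ρ|` and the size of one term -/

/-- Under RH, `|ρ|² = ¼ + (Im ρ)²`. [folklore] -/
theorem norm_sq_eq_of_RH (hRH : RiemannHypothesis) (ρ : Zeros) :
    ‖(ρ : ℂ)‖ ^ 2 = 1 / 4 + (ρ : ℂ).im ^ 2 := by
  rw [Complex.sq_norm, Complex.normSq_apply, re_eq_half_of_RH hRH ρ.2]
  ring

/-- `0 < |ρ|`. [folklore] -/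
theorem norm_pos (ρ : Zeros) : 0 < ‖(ρ : ℂ)‖ := norm_pos_iff.2 (ne_zero ρ.2)

/-- **One zero, low height**: under RH, for `0 < x ≤ y`,
`‖zeroTerm ρ y − zeroTerm ρ x‖ ≤ m(ρ)(y − x)√y/|ρ|`, because
`(y^{ρ+1} − x^{ρ+1})/(ρ+1) = ∫_x^y t^ρ dt` has modulus `≤ (y−x)√y`.
[cite: Schoenfeld1976, proof of Thm. 10 (via RosserSchoenfeld1975 Lemma 8)] -/
theorem norm_zeroTerm_sub_le_low (hRH : RiemannHypothesis) (ρ : Zeros) {x y : ℝ} (hx : 0 < x)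
    (hxy : x ≤ y) :
    ‖zeroTerm ρ y - zeroTerm ρ x‖ ≤
      (riemannZetaZeroOrder (ρ : ℂ) : ℝ) * ((y - x) * Real.sqrt y) / ‖(ρ : ℂ)‖ := by
  have hre := re_eq_half_of_RH hRH ρ.2
  have hm := zeroOrder_nonneg' ρ
  have hρ0 : (ρ : ℂ) ≠ 0 := ne_zero ρ.2
  have hρ1 : (ρ : ℂ) + 1 ≠ 0 := add_one_ne_zero ρ.2
  have hy : 0 < y := hx.trans_le hxy
  -- the difference as an integral
  have hint : ∫ t in x..y, (t : ℂ) ^ (ρ : ℂ) =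
      ((y : ℂ) ^ ((ρ : ℂ) + 1) - (x : ℂ) ^ ((ρ : ℂ) + 1)) / ((ρ : ℂ) + 1) :=
    integral_cpow (Or.inl (by rw [hre]; norm_num))
  have hdiff : zeroTerm ρ y - zeroTerm ρ x =
      (riemannZetaZeroOrder (ρ : ℂ) : ℂ) * ((∫ t in x..y, (t : ℂ) ^ (ρ : ℂ)) / (ρ : ℂ)) := by
    rw [hint, zeroTerm, zeroTerm]
    field_simp
  -- the integral is at most `(y - x) √y`
  have hbound : ‖∫ t in x..y, (t : ℂ) ^ (ρ : ℂ)‖ ≤ Real.sqrt y * |y - x| := by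
    refine intervalIntegral.norm_integral_le_of_norm_le_const fun t ht ↦ ?_
    rw [Set.uIoc_of_le hxy] at ht
    have ht0 : 0 < t := hx.trans ht.1
    rw [Complex.norm_cpow_eq_rpow_re_of_pos ht0, hre, ← Real.sqrt_eq_rpow]
    exact Real.sqrt_le_sqrt ht.2
  rw [hdiff, norm_mul, Complex.norm_intCast, abs_of_nonneg hm, norm_div, mul_div_assoc]
  refine mul_le_mul_of_nonneg_left ?_ hm
  rw [abs_of_nonneg (by linarith)] at hbound
  exact div_le_div_of_nonneg_right (by nlinarith [Real.sqrt_nonneg y]) (norm_nonneg _)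

/-- **One zero, large height**: under RH, for `0 < x ≤ y`,
`‖zeroTerm ρ y − zeroTerm ρ x‖ ≤ 2 m(ρ) y^{3/2}/|ρ|²` (each term is at most `m(ρ) t^{3/2}/|ρ|²`,
`NicolasJExplicit.norm_zeroTerm_le`). [cite: Schoenfeld1976, proof of Thm. 10] -/
theorem norm_zeroTerm_sub_le_high (hRH : RiemannHypothesis) (ρ : Zeros) {x y : ℝ} (hx : 0 < x)
    (hxy : x ≤ y) :
    ‖zeroTerm ρ y - zeroTerm ρ x‖ ≤
      2 * y ^ (3 / 2 : ℝ) * ((riemannZetaZeroOrder (ρ : ℂ) : ℝ) / ‖(ρ : ℂ)‖ ^ 2) := by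
  have hy : 0 < y := hx.trans_le hxy
  have h1 := norm_zeroTerm_le hRH ρ hy
  have h2 := norm_zeroTerm_le hRH ρ hx
  have hm : 0 ≤ (riemannZetaZeroOrder (ρ : ℂ) : ℝ) / ‖(ρ : ℂ)‖ ^ 2 :=
    div_nonneg (zeroOrder_nonneg' ρ) (sq_nonneg _)
  have hxy' : x ^ (3 / 2 : ℝ) ≤ y ^ (3 / 2 : ℝ) := Real.rpow_le_rpow hx.le hxy (by norm_num)
  calc ‖zeroTerm ρ y - zeroTerm ρ x‖ ≤ ‖zeroTerm ρ y‖ + ‖zeroTerm ρ x‖ := norm_sub_le _ _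
    _ ≤ (riemannZetaZeroOrder (ρ : ℂ) : ℝ) / ‖(ρ : ℂ)‖ ^ 2 * y ^ (3 / 2 : ℝ) +
        (riemannZetaZeroOrder (ρ : ℂ) : ℝ) / ‖(ρ : ℂ)‖ ^ 2 * x ^ (3 / 2 : ℝ) := add_le_add h1 h2
    _ ≤ 2 * y ^ (3 / 2 : ℝ) * ((riemannZetaZeroOrder (ρ : ℂ) : ℝ) / ‖(ρ : ℂ)‖ ^ 2) := by
        nlinarith [mul_le_mul_of_nonneg_left hxy' hm]

/-! ### The differenced zero sum -/

/-- **`‖Z(y) − Z(x)‖ ≤ (y − x)√y · sumInvNorm T + 2y^{3/2}(β − sumInvNormSq T)`** under RH, for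
`1 ≤ x ≤ y` and any `T`: the zeros with `|Im ρ| ≤ T` are estimated by `norm_zeroTerm_sub_le_low`,
the others by `norm_zeroTerm_sub_le_high`, and `∑_{|Im ρ| > T} m(ρ)/|ρ|² = β − sumInvNormSq T`.
[cite: Schoenfeld1976, proof of Thm. 10 (via RosserSchoenfeld1975 Lemma 8, m = 1)] -/
theorem norm_Zsum_sub_le (hRH : RiemannHypothesis) {x y : ℝ} (hx : 1 ≤ x) (hxy : x ≤ y) (T : ℝ) :
    ‖Zsum y - Zsum x‖ ≤ (y - x) * Real.sqrt y * sumInvNorm T +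
      2 * y ^ (3 / 2 : ℝ) * (nicolasBeta - sumInvNormSq T) := by
  classical
  have hx0 : 0 < x := by linarith
  have hy : 1 ≤ y := hx.trans hxy
  have hy0 : 0 < y := hx0.trans_le hxy
  -- the difference as one series
  have hZ : Zsum y - Zsum x = ∑' ρ : Zeros, (zeroTerm ρ y - zeroTerm ρ x) := by
    rw [Zsum, Zsum, ← (summable_zeroTerm hy).tsum_sub (summable_zeroTerm hx)]
  -- the majorant: `g₁ + g₂`
  set c : Zeros → ℝ := fun ρ ↦ (riemannZetaZeroOrder (ρ : ℂ) : ℝ) / ‖(ρ : ℂ)‖ ^ 2 with hc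
  set g₁ : Zeros → ℝ := fun ρ ↦ 2 * y ^ (3 / 2 : ℝ) * c ρ with hg₁
  set g₂ : Zeros → ℝ := fun ρ ↦ if ρ ∈ zerosUpTo T then
      (y - x) * Real.sqrt y * ((riemannZetaZeroOrder (ρ : ℂ) : ℝ) / ‖(ρ : ℂ)‖) -
        2 * y ^ (3 / 2 : ℝ) * c ρ else 0 with hg₂
  have h₁ : HasSum g₁ (2 * y ^ (3 / 2 : ℝ) * nicolasBeta) :=
    (hasSum_zeroOrder_div_norm_sq_of_RH hRH).mul_left _
  have h₂ : HasSum g₂ ((y - x) * Real.sqrt y * sumInvNorm T - 2 * y ^ (3 / 2 : ℝ) * sumInvNormSq T) := by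
    have h : HasSum g₂ (∑ ρ ∈ zerosUpTo T, g₂ ρ) :=
      hasSum_sum_of_ne_finset_zero (fun ρ hρ ↦ by simp only [hg₂]; rw [if_neg hρ])
    have hs : ∑ ρ ∈ zerosUpTo T, g₂ ρ =
        (y - x) * Real.sqrt y * sumInvNorm T - 2 * y ^ (3 / 2 : ℝ) * sumInvNormSq T := by
      rw [sumInvNorm, sumInvNormSq, Finset.mul_sum, Finset.mul_sum, ← Finset.sum_sub_distrib]
      refine Finset.sum_congr rfl fun ρ hρ ↦ ?_
      simp only [hg₂]
      rw [if_pos hρ]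
    rwa [hs] at h
  have hmaj : ∀ ρ : Zeros, ‖zeroTerm ρ y - zeroTerm ρ x‖ ≤ g₁ ρ + g₂ ρ := by
    intro ρ
    by_cases hρ : ρ ∈ zerosUpTo T
    · simp only [hg₁, hg₂]
      rw [if_pos hρ]
      have h := norm_zeroTerm_sub_le_low hRH ρ hx0 hxy
      have : (riemannZetaZeroOrder (ρ : ℂ) : ℝ) * ((y - x) * Real.sqrt y) / ‖(ρ : ℂ)‖ =
          (y - x) * Real.sqrt y * ((riemannZetaZeroOrder (ρ : ℂ) : ℝ) / ‖(ρ : ℂ)‖) := by ring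
      linarith
    · simp only [hg₁, hg₂]
      rw [if_neg hρ, add_zero]
      exact norm_zeroTerm_sub_le_high hRH ρ hx0 hxy
  have h := tsum_of_norm_bounded (h₁.add h₂) hmaj
  rw [hZ]
  linarith

/-! ### The differencing inequalities and the main bounds -/

/-- `hψ(x) ≤ ψ₁(x+h) − ψ₁(x)` (`ψ` is non-decreasing; `NicolasJ.psiOne_sub_psiOne`). [folklore] -/
theorem mul_psi_le_psiOne_sub {x y : ℝ} (hxy : x ≤ y) : (y - x) * ψ x ≤ psiOne y - psiOne x := by
  rw [psiOne_sub_psiOne hxy]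
  have hΛ : ∀ n : ℕ, (0 : ℝ) ≤ ArithmeticFunction.vonMangoldt n := fun n ↦
    ArithmeticFunction.vonMangoldt_nonneg
  have hs : 0 ≤ ∑ n ∈ Finset.Ioc ⌊x⌋₊ ⌊y⌋₊, (ArithmeticFunction.vonMangoldt n : ℝ) * (y - n) := by
    refine Finset.sum_nonneg fun n hn ↦ mul_nonneg (hΛ n) ?_
    rw [Finset.mem_Ioc] at hn
    rcases le_or_gt 0 y with hy | hy
    · have : (n : ℝ) ≤ y := (Nat.cast_le.2 hn.2).trans (Nat.floor_le hy)
      linarith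
    · have : ⌊y⌋₊ = 0 := Nat.floor_eq_zero.2 (by linarith)
      omega
  linarith

/-- The real form of the differenced explicit formula: for `1 ≤ x ≤ y`,
`R₁(y) − R₁(x) = −Re(Z(y) − Z(x)) − (y − x) log 2π + (Re E(y) − Re E(x))`, `R₁ = ψ₁ − t²/2`.
[cite: MontgomeryVaughan2007, (13.7)] -/
theorem Rone_sub_Rone_eq {x y : ℝ} (hx : 1 ≤ x) (hxy : x ≤ y) :
    Rone y - Rone x = -(Zsum y - Zsum x).re - (y - x) * Real.log (2 * π) +
      ((psiOneRemainder y).re - (psiOneRemainder x).re) := by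
  have hy : 1 ≤ y := hx.trans hxy
  have h1 := congrArg Complex.re (Rone_eq_explicit hy)
  have h2 := congrArg Complex.re (Rone_eq_explicit hx)
  rw [log_two_pi] at h1 h2
  simp only [Complex.ofReal_re, Complex.add_re, Complex.sub_re, Complex.neg_re,
    Complex.re_ofReal_mul] at h1 h2
  simp only [Complex.sub_re]
  linarith

/-- **Upper bound** (Schoenfeld 1976, Thm. 10 in parametrised form): under RH, for `x > 1`,
`h > 0` and any `T`,
`ψ(x) − x ≤ h/2 − log 2π + √(x+h)·sumInvNorm T + (2(x+h)^{3/2}/h)(β − sumInvNormSq T) + x/(2h(x²−1))`.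
From `hψ(x) ≤ ψ₁(x+h) − ψ₁(x) = xh + h²/2 − Re ΔZ − h log 2π + Re ΔE` with `norm_Zsum_sub_le` and
`Re ΔE ≤ x/(2(x²−1))`. [cite: Schoenfeld1976, Thm. 10 (proof, pp. 337–339)] -/
theorem psi_sub_self_le (hRH : RiemannHypothesis) {x h : ℝ} (hx : 1 < x) (hh : 0 < h) (T : ℝ) :
    ψ x - x ≤ h / 2 - Real.log (2 * π) + Real.sqrt (x + h) * sumInvNorm T +
      2 * (x + h) ^ (3 / 2 : ℝ) / h * (nicolasBeta - sumInvNormSq T) + x / (2 * h * (x ^ 2 - 1)) := by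
  set y := x + h with hy
  have hxy : x ≤ y := by linarith
  have hdiff : psiOne y - psiOne x = (y ^ 2 - x ^ 2) / 2 + (Rone y - Rone x) := by
    simp only [Rone]; ring
  have hψ := mul_psi_le_psiOne_sub hxy
  have hR := Rone_sub_Rone_eq hx.le hxy
  have hZ := norm_Zsum_sub_le hRH hx.le hxy T
  have hZre : -(Zsum y - Zsum x).re ≤ ‖Zsum y - Zsum x‖ :=
    (neg_le_abs _).trans (Complex.abs_re_le_norm _)
  have hE := (re_psiOneRemainder_sub_mem hx hxy).2
  have hyx : y - x = h := by rw [hy]; ring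
  rw [hyx] at hψ hR hZ
  -- `h ψ(x) ≤ xh + h²/2 + ‖ΔZ‖ − h log 2π + x/(2(x²−1))`
  have hmain : h * ψ x ≤ x * h + h ^ 2 / 2 + (h * Real.sqrt y * sumInvNorm T +
      2 * y ^ (3 / 2 : ℝ) * (nicolasBeta - sumInvNormSq T)) - h * Real.log (2 * π) +
      x / (2 * (x ^ 2 - 1)) := by
    have : (y ^ 2 - x ^ 2) / 2 = x * h + h ^ 2 / 2 := by rw [hy]; ring
    linarith
  have hx21 : 0 < x ^ 2 - 1 := by nlinarith
  have hdiv : ψ x ≤ (x * h + h ^ 2 / 2 + (h * Real.sqrt y * sumInvNorm T +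
      2 * y ^ (3 / 2 : ℝ) * (nicolasBeta - sumInvNormSq T)) - h * Real.log (2 * π) +
      x / (2 * (x ^ 2 - 1))) / h := by
    rw [le_div_iff₀ hh]; linarith
  rw [sub_le_iff_le_add]
  refine hdiv.trans_eq ?_
  field_simp
  ring

/-- **Lower bound** (Schoenfeld 1976, Thm. 10 in parametrised form): under RH, for `h > 0`,
`x − h > 1` and any `T`,
`ψ(x) − x ≥ −h/2 − log 2π − √x·sumInvNorm T − (2x^{3/2}/h)(β − sumInvNormSq T)`.
From `hψ(x) ≥ ψ₁(x) − ψ₁(x−h) = xh − h²/2 − Re ΔZ − h log 2π + Re ΔE` with `Re ΔE ≥ 0`.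
[cite: Schoenfeld1976, Thm. 10 (proof, pp. 337–339)] -/
theorem neg_le_psi_sub_self (hRH : RiemannHypothesis) {x h : ℝ} (hh : 0 < h) (hxh : 1 < x - h)
    (T : ℝ) :
    -(h / 2) - Real.log (2 * π) - Real.sqrt x * sumInvNorm T -
      2 * x ^ (3 / 2 : ℝ) / h * (nicolasBeta - sumInvNormSq T) ≤ ψ x - x := by
  set x' := x - h with hx'
  have hxx : x' ≤ x := by linarith
  have hdiff : psiOne x - psiOne x' = (x ^ 2 - x' ^ 2) / 2 + (Rone x - Rone x') := by
    simp only [Rone]; ring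
  have hψ := (psiOne_sub_psiOne_bounds hxx).2
  have hR := Rone_sub_Rone_eq hxh.le hxx
  have hZ := norm_Zsum_sub_le hRH hxh.le hxx T
  have hZre : (Zsum x - Zsum x').re ≤ ‖Zsum x - Zsum x'‖ :=
    (le_abs_self _).trans (Complex.abs_re_le_norm _)
  have hE := (re_psiOneRemainder_sub_mem hxh hxx).1
  have hyx : x - x' = h := by rw [hx']; ring
  rw [hyx] at hψ hR hZ
  have hmain : x * h - h ^ 2 / 2 - (h * Real.sqrt x * sumInvNorm T +
      2 * x ^ (3 / 2 : ℝ) * (nicolasBeta - sumInvNormSq T)) - h * Real.log (2 * π) ≤ h * ψ x := by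
    have : (x ^ 2 - x' ^ 2) / 2 = x * h - h ^ 2 / 2 := by rw [hx']; ring
    linarith
  have hdiv : (x * h - h ^ 2 / 2 - (h * Real.sqrt x * sumInvNorm T +
      2 * x ^ (3 / 2 : ℝ) * (nicolasBeta - sumInvNormSq T)) - h * Real.log (2 * π)) / h ≤ ψ x := by
    rw [div_le_iff₀ hh]; linarith
  rw [le_sub_iff_add_le]
  refine le_trans (le_of_eq ?_) hdiv
  field_simp
  ring

end SchoenfeldBound

end Literature.NumberTheory.LFunctions

end
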